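import Summits.KontsevichZagierPeriods.KontsevichZagierPeriods.Theses.CobordismMove
import Literature.NumberTheory.Transcendental.SemialgebraicMapsProofs
import Literature.NumberTheory.Transcendental.KZSemialgebraicComplex
import Literature.NumberTheory.Transcendental.KZIntervalPeriodProofs

/-!
# `EllipsoidGaussMapCoV` (stmt-KontsevichZagierPeriods-5569, route CobordismMove) — proof

THE GAUSS MAP OF THE ELLIPSOID IS ONE MOVE OF RULE (2). For rational `A, B, C > 0`, every
representation `r = [U, f]` on the open ellipse `U = {x²/A + y²/B < 1}` with
`f = 1/(A·B·z·√M³)`, `z = √(C(1 − x²/A − y²/B))`, `M = x²/A² + y²/B² + (1 − x²/A − y²/B)/C`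
(the Gauss-curvature density `K dA` of the upper half of the ellipsoid `x²/A + y²/B + z²/C = 1`
in the `(x, y)`-projection) and every `r' = [D, g]` on the open unit disc `D` with
`g = 1/√(1 − |w|²)` (the area density of the upper unit hemisphere in projection) satisfy
`[r] − [r'] ∈ KZ.changeOfVariablesRel` — membership in the move SET, one move exactly.

The move is the projected Gauss map `Φ(x, y) = (x/A, y/B)/√M` (first two components of the unit
normal `(x/A, y/B, z/C)/√M`):
* `Φ` is `ℚ`-semialgebraic on `U` (coordinates: polynomial, square root, quotient; `M > 0` on `U`);
* `Φ` is differentiable on `U` with explicit Jacobian `Φ′` and `det Φ′ = 1/(A·B·C·M²) = K > 0`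
  (`Matrix.det_fin_two_of`), while `1 − |Φ|² = (1 − x²/A − y²/B)/(C·M)`, so that
  `f = (g ∘ Φ)·|det Φ′|` on `U` ("`K dA_E = dA_{S²}`");
* `Ψ(w) = (A w₀, B w₁)/√(A w₀² + B w₁² + C(1 − |w|²))` (the point of the ellipsoid with prescribed
  unit normal) satisfies `Ψ ∘ Φ = id` on `U` (injectivity) and `Φ ∘ Ψ = id` on `D`, `Ψ(D) ⊆ U`,
  `Φ(U) ⊆ D`, so `Φ '' U = D` exactly.
No definition is introduced: `M`, `Φ`, `Φ′` enter the lemmas through defining hypotheses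
(`hm`, `hΦ`, `hJ`) and are instantiated by `obtain … := ⟨_, fun _ => rfl⟩` in the final proof.
Pattern of `Theorems/LinkTwistWritheArchimedesCoV.lean`.
References: M. Kontsevich, D. Zagier, *Periods* (2001), §1.2 rule (2); C. F. Gauss,
*Disquisitiones generales circa superficies curvas* (1828), art. 6–8; J. Bochnak, M. Coste,
M.-F. Roy, *Real Algebraic Geometry* (1998), Prop. 2.2.6.
-/

noncomputable section

open MeasureTheory Set
open Literature.NumberTheory.Transcendental
open Literature.ModelTheory.ExponentialFields (IsSemialgebraic)

namespace Summit.KontsevichZagierPeriods.CobordismMove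

/-- On the open ellipse `x²/a + y²/b < 1` the squared length `M = x²/a² + y²/b² + (1 − x²/a − y²/b)/c`
of the half-gradient of `x²/a + y²/b + z²/c` is positive; `√M` is a positive `q` with `q² = M`, also
in the denominator-free form `q²a²b²c = b²c x² + a²c y² + ab(ab − bx² − ay²)`. [folklore] -/
theorem exists_sqrt_normSq {a b c : ℝ} (ha : 0 < a) (hb : 0 < b) (hc : 0 < c)
    {m : (Fin 2 → ℝ) → ℝ}
    (hm : ∀ p, m p = p 0 ^ 2 / a ^ 2 + p 1 ^ 2 / b ^ 2 + (1 - p 0 ^ 2 / a - p 1 ^ 2 / b) / c)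
    {p : Fin 2 → ℝ} (hp : p 0 ^ 2 / a + p 1 ^ 2 / b < 1) :
    ∃ q : ℝ, 0 < q ∧ √(m p) = q ∧ q ^ 2 = m p ∧
      q ^ 2 * (a ^ 2 * b ^ 2 * c) =
        b ^ 2 * c * p 0 ^ 2 + a ^ 2 * c * p 1 ^ 2 + a * b * (a * b - b * p 0 ^ 2 - a * p 1 ^ 2) := by
  have h1 : 0 < 1 - p 0 ^ 2 / a - p 1 ^ 2 / b := by linarith
  have hM : 0 < m p := by
    rw [hm]
    exact add_pos_of_nonneg_of_pos (by positivity) (div_pos h1 hc)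
  refine ⟨√(m p), Real.sqrt_pos.2 hM, rfl, Real.sq_sqrt hM.le, ?_⟩
  rw [Real.sq_sqrt hM.le, hm]
  field_simp

/-- **Left inverse of the projected Gauss map.** With `Φ(x, y) = (x/a, y/b)/√M` and
`Ψ(w) = (a w₀, b w₁)/√(a w₀² + b w₁² + c(1 − |w|²))`, `Ψ (Φ p) = p` on the open ellipse: indeed
`a Φ₀² + b Φ₁² + c(1 − |Φ|²) = (x²/a + y²/b + z²/c)/M = 1/M`. [folklore] -/
theorem leftInverse_gauss {a b c : ℝ} (ha : 0 < a) (hb : 0 < b) (hc : 0 < c)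
    {m : (Fin 2 → ℝ) → ℝ}
    (hm : ∀ p, m p = p 0 ^ 2 / a ^ 2 + p 1 ^ 2 / b ^ 2 + (1 - p 0 ^ 2 / a - p 1 ^ 2 / b) / c)
    {Φ : (Fin 2 → ℝ) → Fin 2 → ℝ} (hΦ : ∀ p, Φ p = ![p 0 / (a * √(m p)), p 1 / (b * √(m p))])
    {p : Fin 2 → ℝ} (hp : p 0 ^ 2 / a + p 1 ^ 2 / b < 1) :
    (![a * Φ p 0 / √(a * Φ p 0 ^ 2 + b * Φ p 1 ^ 2 + c * (1 - Φ p 0 ^ 2 - Φ p 1 ^ 2)),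
       b * Φ p 1 / √(a * Φ p 0 ^ 2 + b * Φ p 1 ^ 2 + c * (1 - Φ p 0 ^ 2 - Φ p 1 ^ 2))] :
      Fin 2 → ℝ) = p := by
  obtain ⟨q, hq0, hq, -, hrel⟩ := exists_sqrt_normSq ha hb hc hm hp
  have key : a * (p 0 / (a * q)) ^ 2 + b * (p 1 / (b * q)) ^ 2 +
      c * (1 - (p 0 / (a * q)) ^ 2 - (p 1 / (b * q)) ^ 2) = (1 / q) ^ 2 := by
    field_simp
    linear_combination hrel
  simp only [hΦ, hq, Matrix.cons_val_zero, Matrix.cons_val_one, key,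
    Real.sqrt_sq (le_of_lt (by positivity : (0 : ℝ) < 1 / q))]
  ext i
  fin_cases i
  · simp
    field_simp
  · simp
    field_simp

/-- **The projected Gauss map is injective on the open ellipse** (it has the left inverse `Ψ` of
`leftInverse_gauss`; geometrically: strict convexity of the ellipsoid). [folklore] -/
theorem injOn_gauss {a b c : ℝ} (ha : 0 < a) (hb : 0 < b) (hc : 0 < c)
    {m : (Fin 2 → ℝ) → ℝ}
    (hm : ∀ p, m p = p 0 ^ 2 / a ^ 2 + p 1 ^ 2 / b ^ 2 + (1 - p 0 ^ 2 / a - p 1 ^ 2 / b) / c)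
    {Φ : (Fin 2 → ℝ) → Fin 2 → ℝ} (hΦ : ∀ p, Φ p = ![p 0 / (a * √(m p)), p 1 / (b * √(m p))]) :
    InjOn Φ {p : Fin 2 → ℝ | p 0 ^ 2 / a + p 1 ^ 2 / b < 1} := by
  intro x hx y hy hxy
  rw [← leftInverse_gauss ha hb hc hm hΦ hx, ← leftInverse_gauss ha hb hc hm hΦ hy, hxy]

/-- **The projected Gauss map maps the open ellipse onto the open unit disc**:
`|Φ p|² = (x²/a² + y²/b²)/M < 1` since `M − x²/a² − y²/b² = (1 − x²/a − y²/b)/c > 0`, and for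
`|w| < 1` the point `Ψ(w) = (a w₀, b w₁)/Q`, `Q² = a w₀² + b w₁² + c(1 − |w|²) > a w₀² + b w₁²`, lies in
the ellipse with `M(Ψ w) = 1/Q²`, whence `Φ(Ψ w) = w`. [folklore] -/
theorem image_gauss {a b c : ℝ} (ha : 0 < a) (hb : 0 < b) (hc : 0 < c)
    {m : (Fin 2 → ℝ) → ℝ}
    (hm : ∀ p, m p = p 0 ^ 2 / a ^ 2 + p 1 ^ 2 / b ^ 2 + (1 - p 0 ^ 2 / a - p 1 ^ 2 / b) / c)
    {Φ : (Fin 2 → ℝ) → Fin 2 → ℝ} (hΦ : ∀ p, Φ p = ![p 0 / (a * √(m p)), p 1 / (b * √(m p))]) :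
    Φ '' {p : Fin 2 → ℝ | p 0 ^ 2 / a + p 1 ^ 2 / b < 1} =
      {w : Fin 2 → ℝ | w 0 ^ 2 + w 1 ^ 2 < 1} := by
  refine Set.ext fun w => ⟨?_, ?_⟩
  · rintro ⟨p, hp : p 0 ^ 2 / a + p 1 ^ 2 / b < 1, rfl⟩
    obtain ⟨q, hq0, hq, -, hrel⟩ := exists_sqrt_normSq ha hb hc hm hp
    simp only [Set.mem_setOf_eq, hΦ, hq, Matrix.cons_val_zero, Matrix.cons_val_one]
    have e : (p 0 / (a * q)) ^ 2 + (p 1 / (b * q)) ^ 2 =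
        (b ^ 2 * p 0 ^ 2 + a ^ 2 * p 1 ^ 2) / (a ^ 2 * b ^ 2 * q ^ 2) := by
      field_simp
    rw [e, div_lt_one (by positivity)]
    have h1 : 0 < 1 - p 0 ^ 2 / a - p 1 ^ 2 / b := by linarith
    have h2 : 0 < a * b * (a * b - b * p 0 ^ 2 - a * p 1 ^ 2) := by
      have : a * b * (a * b - b * p 0 ^ 2 - a * p 1 ^ 2) =
          a ^ 2 * b ^ 2 * (1 - p 0 ^ 2 / a - p 1 ^ 2 / b) := by
        field_simp
      rw [this]
      positivity
    have h3 : c * (a ^ 2 * b ^ 2 * q ^ 2 - (b ^ 2 * p 0 ^ 2 + a ^ 2 * p 1 ^ 2)) =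
        a * b * (a * b - b * p 0 ^ 2 - a * p 1 ^ 2) := by
      linear_combination hrel
    have h4 : 0 < c * (a ^ 2 * b ^ 2 * q ^ 2 - (b ^ 2 * p 0 ^ 2 + a ^ 2 * p 1 ^ 2)) := by
      rw [h3]
      exact h2
    linarith [pos_of_mul_pos_right h4 hc.le]
  · rintro (hw : w 0 ^ 2 + w 1 ^ 2 < 1)
    have hQ : 0 < a * w 0 ^ 2 + b * w 1 ^ 2 + c * (1 - w 0 ^ 2 - w 1 ^ 2) := by
      have : 0 < c * (1 - w 0 ^ 2 - w 1 ^ 2) := mul_pos hc (by linarith)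
      positivity
    obtain ⟨Q, hQ0, hQ2, hQe⟩ : ∃ Q : ℝ, 0 < Q ∧
        Q ^ 2 = a * w 0 ^ 2 + b * w 1 ^ 2 + c * (1 - w 0 ^ 2 - w 1 ^ 2) ∧
        √(a * w 0 ^ 2 + b * w 1 ^ 2 + c * (1 - w 0 ^ 2 - w 1 ^ 2)) = Q :=
      ⟨_, Real.sqrt_pos.2 hQ, Real.sq_sqrt hQ.le, rfl⟩
    have hP : (a * w 0 / Q) ^ 2 / a + (b * w 1 / Q) ^ 2 / b < 1 := by
      have e : (a * w 0 / Q) ^ 2 / a + (b * w 1 / Q) ^ 2 / b =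
          (a * w 0 ^ 2 + b * w 1 ^ 2) / Q ^ 2 := by
        field_simp
      rw [e, div_lt_one (by positivity), hQ2]
      linarith [mul_pos hc (by linarith : (0 : ℝ) < 1 - w 0 ^ 2 - w 1 ^ 2)]
    refine ⟨![a * w 0 / Q, b * w 1 / Q], hP, ?_⟩
    have hmP : m ![a * w 0 / Q, b * w 1 / Q] = (1 / Q) ^ 2 := by
      rw [hm]
      simp only [Matrix.cons_val_zero, Matrix.cons_val_one]
      field_simp
      linear_combination hQ2
    rw [hΦ, hmP, Real.sqrt_sq (le_of_lt (by positivity : (0 : ℝ) < 1 / Q))]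
    simp only [Matrix.cons_val_zero, Matrix.cons_val_one]
    ext i
    fin_cases i
    · simp
      field_simp
    · simp
      field_simp

/-- **The change-of-variables identity `K dA_E = dA_{S²}` in projected coordinates.** On the open
ellipse, with `q = √M`, `t = z = √(c(1 − x²/a − y²/b))` and the Jacobian `Φ′` of
`Φ = (x/a, y/b)/q` below: `det Φ′ = 1/(abc M²)` (`Matrix.det_fin_two_of`; the cofactor expansion
collapses to `(M − (M − 1/c))/(ab M²)`), `1 − |Φ|² = (t/(cq))²`, hence
`1/(ab·t·q³) = (1/√(1 − |Φ|²))·|det Φ′|`. [folklore] -/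
theorem integrand_gauss {a b c : ℝ} (ha : 0 < a) (hb : 0 < b) (hc : 0 < c)
    {m : (Fin 2 → ℝ) → ℝ}
    (hm : ∀ p, m p = p 0 ^ 2 / a ^ 2 + p 1 ^ 2 / b ^ 2 + (1 - p 0 ^ 2 / a - p 1 ^ 2 / b) / c)
    {Φ : (Fin 2 → ℝ) → Fin 2 → ℝ} (hΦ : ∀ p, Φ p = ![p 0 / (a * √(m p)), p 1 / (b * √(m p))])
    {J : (Fin 2 → ℝ) → Matrix (Fin 2) (Fin 2) ℝ}
    (hJ : ∀ p, J p = !![1 / (a * √(m p)) - p 0 * (p 0 / a ^ 2 - p 0 / (a * c)) / (a * m p * √(m p)),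
        -(p 0 * (p 1 / b ^ 2 - p 1 / (b * c))) / (a * m p * √(m p));
        -(p 1 * (p 0 / a ^ 2 - p 0 / (a * c))) / (b * m p * √(m p)),
        1 / (b * √(m p)) - p 1 * (p 1 / b ^ 2 - p 1 / (b * c)) / (b * m p * √(m p))])
    {p : Fin 2 → ℝ} (hp : p 0 ^ 2 / a + p 1 ^ 2 / b < 1) :
    1 / (a * b * √(c * (1 - p 0 ^ 2 / a - p 1 ^ 2 / b)) *
        √(p 0 ^ 2 / a ^ 2 + p 1 ^ 2 / b ^ 2 + (1 - p 0 ^ 2 / a - p 1 ^ 2 / b) / c) ^ 3) =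
      1 / √(1 - Φ p 0 ^ 2 - Φ p 1 ^ 2) *
        |(LinearMap.toContinuousLinearMap (Matrix.toLin' (J p))).det| := by
  obtain ⟨q, hq0, hq, hq2, hrel⟩ := exists_sqrt_normSq ha hb hc hm hp
  have h1 : 0 < 1 - p 0 ^ 2 / a - p 1 ^ 2 / b := by linarith
  obtain ⟨t, ht0, ht2, ht⟩ : ∃ t : ℝ, 0 < t ∧ t ^ 2 = c * (1 - p 0 ^ 2 / a - p 1 ^ 2 / b) ∧
      √(c * (1 - p 0 ^ 2 / a - p 1 ^ 2 / b)) = t :=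
    ⟨_, Real.sqrt_pos.2 (by positivity), Real.sq_sqrt (by positivity), rfl⟩
  rw [← hm, LinearMap.det_toContinuousLinearMap, LinearMap.det_toLin', hJ, Matrix.det_fin_two_of,
    ht]
  simp only [hΦ, hq, Matrix.cons_val_zero, Matrix.cons_val_one]
  rw [← hq2]
  have hdet : (1 / (a * q) - p 0 * (p 0 / a ^ 2 - p 0 / (a * c)) / (a * q ^ 2 * q)) *
        (1 / (b * q) - p 1 * (p 1 / b ^ 2 - p 1 / (b * c)) / (b * q ^ 2 * q)) -
      -(p 0 * (p 1 / b ^ 2 - p 1 / (b * c))) / (a * q ^ 2 * q) *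
        (-(p 1 * (p 0 / a ^ 2 - p 0 / (a * c))) / (b * q ^ 2 * q)) =
      1 / (a * b * c * q ^ 4) := by
    field_simp
    linear_combination (c * q ^ 2) * hrel
  have ht2' : t ^ 2 * (a * b) = a * b * c - b * c * p 0 ^ 2 - a * c * p 1 ^ 2 := by
    rw [ht2]
    field_simp
  have hW : 1 - (p 0 / (a * q)) ^ 2 - (p 1 / (b * q)) ^ 2 = (t / (c * q)) ^ 2 := by
    field_simp
    linear_combination c * hrel - a * b * ht2'
  rw [hdet, hW, Real.sqrt_sq (by positivity), abs_of_pos (by positivity)]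
  field_simp

/-- **The projected Gauss map is differentiable on the open ellipse, with derivative its explicit
Jacobian** `Φ′ = (δᵢⱼ/(dᵢ q) − pᵢ ∂ⱼM/(2 dᵢ M q))`, `d = (a, b)`, `q = √M`
(`hasFDerivAt_pi'`; product and chain rules for `pᵢ · dᵢ⁻¹ · (√M)⁻¹`, `M` a quadratic polynomial,
`M ≠ 0` on the ellipse). [folklore] -/
theorem hasFDerivAt_gauss {a b c : ℝ} (ha : 0 < a) (hb : 0 < b) (hc : 0 < c)
    {m : (Fin 2 → ℝ) → ℝ}
    (hm : ∀ p, m p = p 0 ^ 2 / a ^ 2 + p 1 ^ 2 / b ^ 2 + (1 - p 0 ^ 2 / a - p 1 ^ 2 / b) / c)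
    {Φ : (Fin 2 → ℝ) → Fin 2 → ℝ} (hΦ : ∀ p, Φ p = ![p 0 / (a * √(m p)), p 1 / (b * √(m p))])
    {J : (Fin 2 → ℝ) → Matrix (Fin 2) (Fin 2) ℝ}
    (hJ : ∀ p, J p = !![1 / (a * √(m p)) - p 0 * (p 0 / a ^ 2 - p 0 / (a * c)) / (a * m p * √(m p)),
        -(p 0 * (p 1 / b ^ 2 - p 1 / (b * c))) / (a * m p * √(m p));
        -(p 1 * (p 0 / a ^ 2 - p 0 / (a * c))) / (b * m p * √(m p)),
        1 / (b * √(m p)) - p 1 * (p 1 / b ^ 2 - p 1 / (b * c)) / (b * m p * √(m p))])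
    {p : Fin 2 → ℝ} (hp : p 0 ^ 2 / a + p 1 ^ 2 / b < 1) :
    HasFDerivAt Φ (LinearMap.toContinuousLinearMap (Matrix.toLin' (J p))) p := by
  obtain ⟨q, hq0, hq, hq2, -⟩ := exists_sqrt_normSq ha hb hc hm hp
  have hMne : m p ≠ 0 := by
    rw [← hq2]
    positivity
  have hqne : √(m p) ≠ 0 := by
    rw [hq]
    exact hq0.ne'
  have h0 : HasFDerivAt (fun x : Fin 2 → ℝ => x 0)
      (ContinuousLinearMap.proj (R := ℝ) (φ := fun _ : Fin 2 => ℝ) 0) p := hasFDerivAt_apply 0 p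
  have h1 : HasFDerivAt (fun x : Fin 2 → ℝ => x 1)
      (ContinuousLinearMap.proj (R := ℝ) (φ := fun _ : Fin 2 => ℝ) 1) p := hasFDerivAt_apply 1 p
  have hM : HasFDerivAt m
      ((1 / a ^ 2 - 1 / (a * c)) • ((2 • p 0 ^ (2 - 1)) •
          ContinuousLinearMap.proj (R := ℝ) (φ := fun _ : Fin 2 => ℝ) 0) +
        (1 / b ^ 2 - 1 / (b * c)) • ((2 • p 1 ^ (2 - 1)) •
          ContinuousLinearMap.proj (R := ℝ) (φ := fun _ : Fin 2 => ℝ) 1)) p := by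
    refine ((((h0.pow 2).const_mul (1 / a ^ 2 - 1 / (a * c))).add
      ((h1.pow 2).const_mul (1 / b ^ 2 - 1 / (b * c)))).add_const (1 / c)).congr_of_eventuallyEq
      (Filter.Eventually.of_forall fun x => ?_)
    simp only [Pi.add_apply]
    rw [hm]
    ring
  have hg : HasDerivAt (fun t : ℝ => (√t)⁻¹) (-(1 / (2 * √(m p))) / √(m p) ^ 2) (m p) :=
    (Real.hasDerivAt_sqrt hMne).inv hqne
  have hcomp := hg.comp_hasFDerivAt p hM
  have hΦ' : Φ = fun x => ![x 0 / (a * √(m x)), x 1 / (b * √(m x))] := funext hΦ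
  subst hΦ'
  rw [hasFDerivAt_pi']
  refine Fin.forall_fin_two.mpr ⟨?_, ?_⟩
  · refine (((h0.mul_const a⁻¹).mul hcomp).congr_of_eventuallyEq
      (Filter.Eventually.of_forall fun x => ?_)).congr_fderiv (ContinuousLinearMap.ext fun v => ?_)
    · simp only [Pi.mul_apply, Function.comp_apply, Matrix.cons_val_zero]
      ring
    · simp [Matrix.toLin'_apply, dotProduct, Fin.sum_univ_two, hq, hJ]
      rw [← hq2]
      field_simp
      ring
  · refine (((h1.mul_const b⁻¹).mul hcomp).congr_of_eventuallyEq
      (Filter.Eventually.of_forall fun x => ?_)).congr_fderiv (ContinuousLinearMap.ext fun v => ?_)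
    · simp only [Pi.mul_apply, Function.comp_apply, Matrix.cons_val_one, Matrix.cons_val_zero]
      ring
    · simp [Matrix.toLin'_apply, dotProduct, Fin.sum_univ_two, hq, hJ]
      rw [← hq2]
      field_simp
      ring

/-- **The projected Gauss map is `ℚ`-semialgebraic on the open ellipse** for rational `A, B, C`:
each coordinate is a coordinate function divided by the rational constant `A` (resp. `B`) times the
square root of the `ℚ`-polynomial `M`, non-vanishing on the ellipse.
[cite: BochnakCosteRoy1998, Prop. 2.2.6] -/
theorem isSemialgebraicMapOn_gauss {A B C : ℚ} (hA : 0 < A) (hB : 0 < B) (hC : 0 < C)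
    {m : (Fin 2 → ℝ) → ℝ}
    (hm : ∀ p, m p = p 0 ^ 2 / (A : ℝ) ^ 2 + p 1 ^ 2 / (B : ℝ) ^ 2 +
      (1 - p 0 ^ 2 / (A : ℝ) - p 1 ^ 2 / (B : ℝ)) / (C : ℝ))
    {Φ : (Fin 2 → ℝ) → Fin 2 → ℝ}
    (hΦ : ∀ p, Φ p = ![p 0 / ((A : ℝ) * √(m p)), p 1 / ((B : ℝ) * √(m p))])
    (hU : IsSemialgebraic ℚ {p : Fin 2 → ℝ | p 0 ^ 2 / (A : ℝ) + p 1 ^ 2 / (B : ℝ) < 1}) :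
    IsSemialgebraicMapOn ℚ {p : Fin 2 → ℝ | p 0 ^ 2 / (A : ℝ) + p 1 ^ 2 / (B : ℝ) < 1} Φ := by
  have ha : (0 : ℝ) < A := by exact_mod_cast hA
  have hb : (0 : ℝ) < B := by exact_mod_cast hB
  have hc : (0 : ℝ) < C := by exact_mod_cast hC
  have hmS : IsSemialgebraicFunOn ℚ {p : Fin 2 → ℝ | p 0 ^ 2 / (A : ℝ) + p 1 ^ 2 / (B : ℝ) < 1} m :=
    (isSemialgebraicFunOn_aeval hU
      (MvPolynomial.C (1 / A ^ 2) * MvPolynomial.X 0 ^ 2 +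
        MvPolynomial.C (1 / B ^ 2) * MvPolynomial.X 1 ^ 2 +
        MvPolynomial.C (1 / C) * (1 - MvPolynomial.C (1 / A) * MvPolynomial.X 0 ^ 2 -
          MvPolynomial.C (1 / B) * MvPolynomial.X 1 ^ 2) : MvPolynomial (Fin 2) ℚ)).congr
      fun x _ => by
        rw [hm]
        simp
        ring
  have hq : IsSemialgebraicFunOn ℚ {p : Fin 2 → ℝ | p 0 ^ 2 / (A : ℝ) + p 1 ^ 2 / (B : ℝ) < 1}
      (fun x => √(m x)) := IsSemialgebraicFunOn.sqrt_holds hmS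
  have hne : ∀ x ∈ {p : Fin 2 → ℝ | p 0 ^ 2 / (A : ℝ) + p 1 ^ 2 / (B : ℝ) < 1}, √(m x) ≠ 0 := by
    intro x hx
    obtain ⟨q, hq0, hqx, -⟩ := exists_sqrt_normSq ha hb hc hm hx
    rw [hqx]
    exact hq0.ne'
  refine IsSemialgebraicMapOn.of_forall hU (Fin.forall_fin_two.mpr ⟨?_, ?_⟩)
  · refine ((isSemialgebraicFunOn_apply hU 0).div
      (IsSemialgebraicFunOn.mul_holds (isSemialgebraicFunOn_ratCast hU A) hq)
      fun x hx => mul_ne_zero ha.ne' (hne x hx)).congr fun x _ => ?_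
    simp [hΦ]
  · refine ((isSemialgebraicFunOn_apply hU 1).div
      (IsSemialgebraicFunOn.mul_holds (isSemialgebraicFunOn_ratCast hU B) hq)
      fun x hx => mul_ne_zero hb.ne' (hne x hx)).congr fun x _ => ?_
    simp [hΦ]

/-- **`EllipsoidGaussMapCoV`** (route CobordismMove, stmt-KontsevichZagierPeriods-5569): for rational
`A, B, C > 0`, every `r = [{x²/A + y²/B < 1}, 1/(A B z √M³)]` (`z = √(C(1 − x²/A − y²/B))`,
`M = x²/A² + y²/B² + z²/C²`: the Gauss-curvature density of the upper half-ellipsoid in projection)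
and every `r' = [{|w| < 1}, 1/√(1 − |w|²)]` (the area density of the upper unit hemisphere in
projection) satisfy `[r] − [r'] ∈ KZ.changeOfVariablesRel`: ONE move of rule (2) along the projected
Gauss map `Φ = (x/A, y/B)/√M` — `ℚ`-semialgebraic, differentiable with `|det Φ′| = K = 1/(ABC M²)`,
injective with inverse `w ↦ (A w₀, B w₁)/√(A w₀² + B w₁² + C(1 − |w|²))`, image the open unit disc,
and `f = (g ∘ Φ)·|det Φ′|`. [cite: KontsevichZagier2001, §1.2] -/
theorem ellipsoidGaussMapCoV_proof :
    Summit.KontsevichZagierPeriods.KontsevichZagierPeriods.Theses.CobordismMove.EllipsoidGaussMapCoV := by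
  intro A B C hA hB hC r r' hrd hri hr'd hr'i
  have ha : (0 : ℝ) < A := by exact_mod_cast hA
  have hb : (0 : ℝ) < B := by exact_mod_cast hB
  have hc : (0 : ℝ) < C := by exact_mod_cast hC
  obtain ⟨m, hm⟩ : ∃ m : (Fin 2 → ℝ) → ℝ, ∀ p, m p = p 0 ^ 2 / (A : ℝ) ^ 2 + p 1 ^ 2 / (B : ℝ) ^ 2 +
      (1 - p 0 ^ 2 / (A : ℝ) - p 1 ^ 2 / (B : ℝ)) / (C : ℝ) := ⟨_, fun _ => rfl⟩
  obtain ⟨Φ, hΦ⟩ : ∃ Φ : (Fin 2 → ℝ) → Fin 2 → ℝ,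
      ∀ p, Φ p = ![p 0 / ((A : ℝ) * √(m p)), p 1 / ((B : ℝ) * √(m p))] := ⟨_, fun _ => rfl⟩
  obtain ⟨J, hJ⟩ : ∃ J : (Fin 2 → ℝ) → Matrix (Fin 2) (Fin 2) ℝ, ∀ p, J p =
      !![1 / ((A : ℝ) * √(m p)) -
          p 0 * (p 0 / (A : ℝ) ^ 2 - p 0 / ((A : ℝ) * (C : ℝ))) / ((A : ℝ) * m p * √(m p)),
        -(p 0 * (p 1 / (B : ℝ) ^ 2 - p 1 / ((B : ℝ) * (C : ℝ)))) / ((A : ℝ) * m p * √(m p));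
        -(p 1 * (p 0 / (A : ℝ) ^ 2 - p 0 / ((A : ℝ) * (C : ℝ)))) / ((B : ℝ) * m p * √(m p)),
        1 / ((B : ℝ) * √(m p)) -
          p 1 * (p 1 / (B : ℝ) ^ 2 - p 1 / ((B : ℝ) * (C : ℝ))) / ((B : ℝ) * m p * √(m p))] :=
    ⟨_, fun _ => rfl⟩
  have hU : IsSemialgebraic ℚ {p : Fin 2 → ℝ | p 0 ^ 2 / (A : ℝ) + p 1 ^ 2 / (B : ℝ) < 1} :=
    hrd ▸ r.isSemialgebraic_domain
  refine ⟨2, r, r', Φ, fun p => LinearMap.toContinuousLinearMap (Matrix.toLin' (J p)), ?_,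
    fun x hx => ?_, ?_, ?_, fun x hx => ?_, rfl⟩
  · rw [hrd]
    exact isSemialgebraicMapOn_gauss hA hB hC hm hΦ hU
  · rw [hrd] at hx
    exact (hasFDerivAt_gauss ha hb hc hm hΦ hJ hx).hasFDerivWithinAt
  · rw [hrd]
    exact injOn_gauss ha hb hc hm hΦ
  · rw [hr'd, hrd, image_gauss ha hb hc hm hΦ]
  · have hx' : x 0 ^ 2 / (A : ℝ) + x 1 ^ 2 / (B : ℝ) < 1 := by
      rw [hrd] at hx
      exact hx
    have hΦx : Φ x ∈ r'.domain := by
      rw [hr'd, ← image_gauss ha hb hc hm hΦ]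
      exact Set.mem_image_of_mem Φ hx'
    rw [hri hx, hr'i hΦx]
    exact integrand_gauss ha hb hc hm hΦ hJ hx'

end Summit.KontsevichZagierPeriods.CobordismMove

end
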